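import Summits.CriticalPhenomena.CardyFormulaZ2.Theorems.CardyBoundaryCoulombGasRectilinearCardyStubRowBlocksPart9
import Summits.CriticalPhenomena.CardyFormulaZ2.Theorems.CardyBoundaryCoulombGasRectilinearCardyClosureDefs
import HarnessLib

/-!
# Stub B `stub_rowBlocks` of line `excursion-kernel-covariance`, part 11: from the two blocks to the
# clauses of the stub (row sets, corners, distinct vertices)
# (crux `RectilinearCardy`, stmt-CriticalPhenomena-5660, route `CardyBoundaryCoulombGas`)

Geometry-free step of the ROW BLOCKS stub. Input: one enumeration `e` of the exterior darts of the
lattice polygon `V` (period `P`, no repetition, all exterior darts) with the combinatorial clauses of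
the BOUNDARY FEET stub (no vertex with three outside neighbours; lattice convex corners are two
consecutive darts entered and left through their two row neighbours), the range-`3` lattice charts of
the engine line (no necks), the block characterisations of part 10 (a row dart `e i` is attributed to
the arc iff `ib ≤ i ≤ ia`, to the tail arc iff `i ≤ 1 ∨ id ≤ i`), and the dictionary between the row
sets `rowArc`, `rowBeyond v` and "boundary-row vertex attributed to the arc / tail arc".
Output (`rb_main_clauses`): the row-set clauses, the corner clauses and the distinct-vertices clause
of the stub, verbatim up to reading `(dsucc V)^[i] d₀` as `e i`.

All [folklore].
-/

noncomputable section

open Set Metric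
open Literature.Probability.RandomPlanarGeometry
open Literature.Probability.LatticeModels (Site meshPoint Orient)
open Literature.Probability.LatticeModels.CollarLegModel (Dart dartTip dir dsucc outDart period neighbours)
open Summit.CriticalPhenomena.CardyFormulaZ2.Cruxes.BoundaryDefectGaussianR.RainbowMonomialsInExcursionKernels
  (s3_outDart_of_card)

namespace Summit.CriticalPhenomena.CardyFormulaZ2.Cruxes.RectilinearCardy.ExcursionKernelCovariance

/-- Directions other than two consecutive ones are the two opposite consecutive ones. [folklore] -/
theorem rb_fin4_cases' (a b : Fin 4) (h0 : b ≠ a) (h1 : b ≠ a + 1) : b = a + 2 ∨ b = a + 3 := by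
  revert a b; decide

/-- **From the two blocks to the clauses of the stub.** See the module docstring. [folklore] -/
theorem rb_main_clauses (R : ConformalRectangle) {δ : ℝ} (hδ : 0 < δ) {V : Finset (ℤ × ℤ)}
    (hVR : ∀ x : ℤ × ℤ, x ∈ V ↔ meshPoint δ (![x.1, x.2] : Site 2) ∈ closure R.carrier)
    {e : ℕ → Dart} {P : ℕ} (hP : 0 < P) (hsucc : ∀ n, e (n + 1) = dsucc V (e n)) (hper : ∀ n, e (n + P) = e n)
    (hext : ∀ n, (e n).1 ∈ V ∧ dartTip (e n) ∉ V) (henum : ∀ d : Dart, d.1 ∈ V → dartTip d ∉ V → ∃ n, n < P ∧ e n = d)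
    (hnodup : ∀ n m, n < P → m < P → e n = e m → n = m)
    (hcard2 : ∀ n, ((neighbours (e n).1).filter (fun y ↦ y ∉ V)).card ≤ 2)
    (hcorner : ∀ n, (e (n + 2)).1 = (e (n + 1)).1 → (e (n + 2)).2 = (e (n + 1)).2 + 1 ∧
      e n = ((e (n + 1)).1 + dir ((e (n + 1)).2 + 3), (e (n + 1)).2) ∧
      e (n + 3) = ((e (n + 1)).1 + dir ((e (n + 1)).2 + 2), (e (n + 1)).2 + 1) ∧
      ((neighbours (e n).1).filter (fun y ↦ y ∉ V)).card = 1 ∧ ((neighbours (e (n + 3)).1).filter (fun y ↦ y ∉ V)).card = 1)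
    (hchart : ∀ u ∈ V, ∀ k : Fin 4, u + dir k ∉ V → ∃ (K : Fin 4) (c₁ c₂ : ℤ),
      (∀ v : ℤ × ℤ, |v.1 - u.1| ≤ 3 → |v.2 - u.2| ≤ 3 → (v ∈ V ↔ c₂ ≤ v.1 * (dir (K + 1)).1 + v.2 * (dir (K + 1)).2)) ∨
      (∀ v : ℤ × ℤ, |v.1 - u.1| ≤ 3 → |v.2 - u.2| ≤ 3 → (v ∈ V ↔ c₁ ≤ v.1 * (dir K).1 + v.2 * (dir K).2 ∧ c₂ ≤ v.1 * (dir (K + 1)).1 + v.2 * (dir (K + 1)).2)) ∨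
      (∀ v : ℤ × ℤ, |v.1 - u.1| ≤ 3 → |v.2 - u.2| ≤ 3 → (v ∈ V ↔ c₂ ≤ v.1 * (dir (K + 1)).1 + v.2 * (dir (K + 1)).2 ∨ v.1 * (dir K).1 + v.2 * (dir K).2 ≤ c₁)))
    {v : Site 2} (hv1 : (e 1).1 = ((v 0, v 1) : ℤ × ℤ)) {ib ia id : ℕ} (hib : 3 < ib) (hibia : ib < ia) (hiaid : ia + 1 < id) (hidP : id + 3 < P)
    (hcard0 : ((neighbours (e 0).1).filter (fun y ↦ y ∉ V)).card = 1) (hcard1 : ((neighbours (e 1).1).filter (fun y ↦ y ∉ V)).card = 1)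
    (hcardb : ((neighbours (e ib).1).filter (fun y ↦ y ∉ V)).card = 1) (hcarda : ((neighbours (e ia).1).filter (fun y ↦ y ∉ V)).card = 1)
    (hcardd : ((neighbours (e id).1).filter (fun y ↦ y ∉ V)).card = 1)
    {A₁ A₂ F₁ F₂ : Set ℂ}
    (harc : ∀ i < P, (((neighbours (e i).1).filter (fun y ↦ y ∉ V)).card = 1 ∧
        infDist (meshPoint δ (![(e i).1.1, (e i).1.2] : Site 2)) A₁ ≤ infDist (meshPoint δ (![(e i).1.1, (e i).1.2] : Site 2)) F₁) ↔
      ib ≤ i ∧ i ≤ ia ∧ ((neighbours (e i).1).filter (fun y ↦ y ∉ V)).card = 1)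
    (htail : ∀ i < P, (((neighbours (e i).1).filter (fun y ↦ y ∉ V)).card = 1 ∧
        infDist (meshPoint δ (![(e i).1.1, (e i).1.2] : Site 2)) A₂ ≤ infDist (meshPoint δ (![(e i).1.1, (e i).1.2] : Site 2)) F₂) ↔
      (i ≤ 1 ∨ id ≤ i) ∧ ((neighbours (e i).1).filter (fun y ↦ y ∉ V)).card = 1)
    (hrowArc : ∀ y : Site 2, y ∈ rowArc R δ ↔ y ∈ boundaryRow R δ ∧ infDist (meshPoint δ y) A₁ ≤ infDist (meshPoint δ y) F₁)
    (hrowBey : ∀ y : Site 2, y ∈ rowBeyond R δ v ↔ y ∈ boundaryRow R δ ∧ y ≠ v ∧ infDist (meshPoint δ y) A₂ ≤ infDist (meshPoint δ y) F₂) :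
    (∀ x : ℤ × ℤ, (∃ y ∈ rowArc R δ, ((y 0, y 1) : ℤ × ℤ) = x) ↔
      ∃ i : ℕ, ib ≤ i ∧ i ≤ ia ∧ (e i).1 = x ∧ ((neighbours (e i).1).filter (fun y ↦ y ∉ V)).card = 1) ∧
    (∀ x : ℤ × ℤ, (∃ y ∈ rowBeyond R δ v, ((y 0, y 1) : ℤ × ℤ) = x) ↔
      (∃ i : ℕ, id ≤ i ∧ i < P ∧ (e i).1 = x ∧ ((neighbours (e i).1).filter (fun y ↦ y ∉ V)).card = 1) ∨ x = (e 0).1) ∧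
    (∀ i : ℕ, ib ≤ i → i ≤ ia → ((neighbours (e i).1).filter (fun y ↦ y ∉ V)).card ≠ 1 →
      ∀ w ∈ V, (w.1 - (e i).1.1) ^ 2 + (w.2 - (e i).1.2) ^ 2 = 1 → ∃ y ∈ rowArc R δ, ((y 0, y 1) : ℤ × ℤ) = w) ∧
    (∀ i : ℕ, id ≤ i → i < P → ((neighbours (e i).1).filter (fun y ↦ y ∉ V)).card ≠ 1 →
      ∀ w ∈ V, (w.1 - (e i).1.1) ^ 2 + (w.2 - (e i).1.2) ^ 2 = 1 → ∃ y ∈ rowBeyond R δ v, ((y 0, y 1) : ℤ × ℤ) = w) ∧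
    (∀ i : ℕ, ib ≤ i → i ≤ ia → (e i).1 ≠ (v 0, v 1) ∧ (e i).1 ≠ (e 0).1 ∧ ∀ j : ℕ, id ≤ j → j < P → (e i).1 ≠ (e j).1) := by
  -- dictionary between row sets and indices
  have hiaP : ia < P := by omega
  have hrow_of : ∀ i, ((neighbours (e i).1).filter (fun y ↦ y ∉ V)).card = 1 →
      (![(e i).1.1, (e i).1.2] : Site 2) ∈ boundaryRow R δ := fun i hc =>
    (rb_mem_boundaryRow_iff R hδ hVR _).2 ⟨by simpa using (hext i).1, by simpa using hc⟩
  have hindex : ∀ y : Site 2, y ∈ boundaryRow R δ → ∃ i, i < P ∧ (e i).1 = ((y 0, y 1) : ℤ × ℤ) ∧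
      ((neighbours (e i).1).filter (fun y ↦ y ∉ V)).card = 1 ∧ y = (![(e i).1.1, (e i).1.2] : Site 2) := by
    intro y hy
    obtain ⟨hyV, hyc⟩ := (rb_mem_boundaryRow_iff R hδ hVR y).1 hy
    obtain ⟨k, -, hk, -⟩ := s3_outDart_of_card V _ hyc
    obtain ⟨i, hi, hei⟩ := henum (((y 0, y 1) : ℤ × ℤ), k) hyV hk
    refine ⟨i, hi, by rw [hei], by rw [hei]; exact hyc, ?_⟩
    rw [hei]; exact rb_site_of_pair_eq rfl
  have hpair : ∀ x : ℤ × ℤ, (((![x.1, x.2] : Site 2) 0, (![x.1, x.2] : Site 2) 1) : ℤ × ℤ) = x := fun x => by simp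
  -- membership in the two row sets, by index
  have hArc_of : ∀ i < P, ib ≤ i → i ≤ ia → ((neighbours (e i).1).filter (fun y ↦ y ∉ V)).card = 1 →
      (![(e i).1.1, (e i).1.2] : Site 2) ∈ rowArc R δ := fun i hi h1 h2 hc =>
    (hrowArc _).2 ⟨hrow_of i hc, ((harc i hi).2 ⟨h1, h2, hc⟩).2⟩
  have hv_site : v = (![(e 1).1.1, (e 1).1.2] : Site 2) := by rw [hv1]; exact rb_site_of_pair_eq rfl
  have hBey_of : ∀ i < P, (i = 0 ∨ id ≤ i) → ((neighbours (e i).1).filter (fun y ↦ y ∉ V)).card = 1 →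
      (![(e i).1.1, (e i).1.2] : Site 2) ∈ rowBeyond R δ v := by
    intro i hi h1 hc
    refine (hrowBey _).2 ⟨hrow_of i hc, ?_, ((htail i hi).2 ⟨by omega, hc⟩).2⟩
    intro heq
    rw [hv_site] at heq
    have h2 : (e i).1 = (e 1).1 := by
      have := congrArg (fun y : Site 2 => ((y 0, y 1) : ℤ × ℤ)) heq
      simpa using this
    have := rb_index_unique hext hnodup (by omega) hi hcard1 h2
    omega
  -- lattice convex corners on the cycle
  have hF4 := rb_fin4_cases'
  have hcorner_at : ∀ i < P, ((neighbours (e i).1).filter (fun y ↦ y ∉ V)).card ≠ 1 →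
      ∃ k : Fin 4, (e i).1 + dir k ∉ V ∧ (e i).1 + dir (k + 1) ∉ V ∧ (e i).1 + dir (k + 2) ∈ V ∧ (e i).1 + dir (k + 3) ∈ V ∧
        ((e i = ((e i).1, k) ∧ e (i + 1) = ((e i).1, k + 1)) ∨ (e i = ((e i).1, k + 1) ∧ e (i + P - 1) = ((e i).1, k))) := by
    intro i _ hne
    have htip : (e i).1 + dir (e i).2 ∉ V := (hext i).2
    have h2 := rb_card_eq_two htip (hcard2 i) hne
    obtain ⟨K, c₁, c₂, hch⟩ := hchart _ (hext i).1 _ htip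
    obtain ⟨k, hk, hk1, hk2, hk3⟩ := rb_convex_of_card_two h2 (rb_no_neck (hext i).1 hch)
    exact ⟨k, hk, hk1, hk2, hk3, rb_corner_consecutive hP hsucc hper hext hk hk1 hk2 hk3⟩
  -- the two row neighbours of a corner inside a block, by index
  have hcornerA : ∀ m, ∀ k : Fin 4, e (m + 1) = ((e (m + 1)).1, k) → e (m + 2) = ((e (m + 1)).1, k + 1) →
      e m = ((e (m + 1)).1 + dir (k + 3), k) ∧ e (m + 3) = ((e (m + 1)).1 + dir (k + 2), k + 1) ∧
      ((neighbours (e m).1).filter (fun y ↦ y ∉ V)).card = 1 ∧ ((neighbours (e (m + 3)).1).filter (fun y ↦ y ∉ V)).card = 1 := by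
    intro m k h1 h2
    have hk' : (e (m + 1)).2 = k := by rw [h1]
    obtain ⟨-, hm, hm3, hc0, hc3⟩ := hcorner m (by rw [h2])
    rw [hk'] at hm hm3
    exact ⟨hm, hm3, hc0, hc3⟩
  refine ⟨fun x => ⟨?_, ?_⟩, fun x => ⟨?_, ?_⟩, ?_, ?_, ?_⟩
  · -- `rowArc` → block
    rintro ⟨y, hy, rfl⟩
    obtain ⟨hyrow, hattr⟩ := (hrowArc y).1 hy
    obtain ⟨i, hi, hei, hc, hyi⟩ := hindex y hyrow
    rw [hyi] at hattr
    obtain ⟨h1, h2, -⟩ := (harc i hi).1 ⟨hc, hattr⟩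
    exact ⟨i, h1, h2, hei, hc⟩
  · rintro ⟨i, h1, h2, rfl, hc⟩
    exact ⟨_, hArc_of i (by omega) h1 h2 hc, hpair _⟩
  · -- `rowBeyond v` → final block or the origin
    rintro ⟨y, hy, rfl⟩
    obtain ⟨hyrow, hyv, hattr⟩ := (hrowBey y).1 hy
    obtain ⟨i, hi, hei, hc, hyi⟩ := hindex y hyrow
    rw [hyi] at hattr hyv
    obtain ⟨h1 | h1, -⟩ := (htail i hi).1 ⟨hc, hattr⟩
    · interval_cases i
      · exact Or.inr hei.symm
      · exact absurd hv_site.symm hyv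
    · exact Or.inl ⟨i, h1, hi, hei, hc⟩
  · rintro (⟨i, h1, hi, rfl, hc⟩ | rfl)
    · exact ⟨_, hBey_of i hi (Or.inr h1) hc, hpair _⟩
    · exact ⟨_, hBey_of 0 hP (Or.inl rfl) hcard0, hpair _⟩
  · -- corners inside the arc block
    intro i h1 h2 hne w hwV hw1
    have hi : i < P := by omega
    obtain ⟨k, hk, hk1, hk2, hk3, hcases⟩ := hcorner_at i hi hne
    obtain ⟨k'', rfl⟩ := (rb_unit_neighbour w (e i).1).1 hw1
    have hk''0 : k'' ≠ k := fun h => hk (h ▸ hwV)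
    have hk''1 : k'' ≠ k + 1 := fun h => hk1 (h ▸ hwV)
    have hne_b : i ≠ ib := fun h => hne (h ▸ hcardb)
    have hne_a : i ≠ ia := fun h => hne (h ▸ hcarda)
    rcases hcases with ⟨hei, hei1⟩ | ⟨hei, heim⟩
    · obtain ⟨m, rfl⟩ : ∃ m, i = m + 1 := ⟨i - 1, by omega⟩
      obtain ⟨hm, hm3, hc0, hc3⟩ := hcornerA m k hei hei1
      have hne_a' : m + 2 ≠ ia := fun h => by
        have : ((neighbours (e (m + 2)).1).filter (fun y ↦ y ∉ V)).card ≠ 1 := by rw [hei1]; exact hne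
        exact this (h ▸ hcarda)
      rcases hF4 k k'' hk''0 hk''1 with rfl | rfl
      · refine ⟨_, hArc_of (m + 3) (by omega) (by omega) (by omega) hc3, ?_⟩
        rw [hpair, hm3]
      · refine ⟨_, hArc_of m (by omega) (by omega) (by omega) hc0, ?_⟩
        rw [hpair, hm]
    · obtain ⟨m, rfl⟩ : ∃ m, i = m + 2 := ⟨i - 2, by omega⟩
      rw [show m + 2 + P - 1 = (m + 1) + P by omega, hper] at heim
      have hu : (e (m + 1)).1 = (e (m + 2)).1 := by rw [heim]
      obtain ⟨hm, hm3, hc0, hc3⟩ := hcornerA m k (by rw [hu, ← heim]) (by rw [hu]; exact hei)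
      rw [hu] at hm hm3
      have hne_b' : m + 1 ≠ ib := fun h => by
        have : ((neighbours (e (m + 1)).1).filter (fun y ↦ y ∉ V)).card ≠ 1 := by rw [heim]; exact hne
        exact this (h ▸ hcardb)
      rcases hF4 k k'' hk''0 hk''1 with rfl | rfl
      · refine ⟨_, hArc_of (m + 3) (by omega) (by omega) (by omega) hc3, ?_⟩
        rw [hpair, hm3]
      · refine ⟨_, hArc_of m (by omega) (by omega) (by omega) hc0, ?_⟩
        rw [hpair, hm]
  · -- corners inside the final block
    intro i h1 hi hne w hwV hw1
    obtain ⟨k, hk, hk1, hk2, hk3, hcases⟩ := hcorner_at i hi hne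
    obtain ⟨k'', rfl⟩ := (rb_unit_neighbour w (e i).1).1 hw1
    have hk''0 : k'' ≠ k := fun h => hk (h ▸ hwV)
    have hk''1 : k'' ≠ k + 1 := fun h => hk1 (h ▸ hwV)
    have hne_d : i ≠ id := fun h => hne (h ▸ hcardd)
    rcases hcases with ⟨hei, hei1⟩ | ⟨hei, heim⟩
    · obtain ⟨m, rfl⟩ : ∃ m, i = m + 1 := ⟨i - 1, by omega⟩
      obtain ⟨hm, hm3, hc0, hc3⟩ := hcornerA m k hei hei1
      have hP2 : m + 2 ≠ P := fun h => by
        have : ((neighbours (e (m + 2)).1).filter (fun y ↦ y ∉ V)).card ≠ 1 := by rw [hei1]; exact hne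
        rw [h, ← zero_add P, hper] at this
        exact this hcard0
      rcases hF4 k k'' hk''0 hk''1 with rfl | rfl
      · by_cases hP3 : m + 3 = P
        · refine ⟨_, hBey_of 0 hP (Or.inl rfl) hcard0, ?_⟩
          rw [hpair, ← hper 0, zero_add, ← hP3, hm3]
        · refine ⟨_, hBey_of (m + 3) (by omega) (Or.inr (by omega)) hc3, ?_⟩
          rw [hpair, hm3]
      · refine ⟨_, hBey_of m (by omega) (Or.inr (by omega)) hc0, ?_⟩
        rw [hpair, hm]
    · obtain ⟨m, rfl⟩ : ∃ m, i = m + 2 := ⟨i - 2, by omega⟩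
      rw [show m + 2 + P - 1 = (m + 1) + P by omega, hper] at heim
      have hu : (e (m + 1)).1 = (e (m + 2)).1 := by rw [heim]
      obtain ⟨hm, hm3, hc0, hc3⟩ := hcornerA m k (by rw [hu, ← heim]) (by rw [hu]; exact hei)
      rw [hu] at hm hm3
      have hne_d' : m + 1 ≠ id := fun h => by
        have : ((neighbours (e (m + 1)).1).filter (fun y ↦ y ∉ V)).card ≠ 1 := by rw [heim]; exact hne
        exact this (h ▸ hcardd)
      rcases hF4 k k'' hk''0 hk''1 with rfl | rfl
      · by_cases hP3 : m + 3 = P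
        · refine ⟨_, hBey_of 0 hP (Or.inl rfl) hcard0, ?_⟩
          rw [hpair, ← hper 0, zero_add, ← hP3, hm3]
        · refine ⟨_, hBey_of (m + 3) (by omega) (Or.inr (by omega)) hc3, ?_⟩
          rw [hpair, hm3]
      · refine ⟨_, hBey_of m (by omega) (Or.inr (by omega)) hc0, ?_⟩
        rw [hpair, hm]
  · -- distinct vertices
    intro i h1 h2
    have hi : i < P := by omega
    refine ⟨fun h => ?_, fun h => ?_, fun j hj hjP h => ?_⟩
    · have := rb_index_unique hext hnodup (by omega) hi hcard1 (h.trans hv1.symm)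
      omega
    · have := rb_index_unique hext hnodup hP hi hcard0 h
      omega
    · by_cases hcj : ((neighbours (e j).1).filter (fun y ↦ y ∉ V)).card = 1
      · have := rb_index_unique hext hnodup hjP hi hcj h
        omega
      · obtain ⟨k, hk, hk1, hk2, hk3, hcases⟩ := hcorner_at j hjP hcj
        -- the dart `e i` sits at the corner vertex, so it is one of its two darts
        have htip : (e i).1 + dir (e i).2 ∉ V := (hext i).2
        rw [h] at htip
        have hd2 : (e i).2 ≠ k + 2 := fun h' => htip (h' ▸ hk2)
        have hd3 : (e i).2 ≠ k + 3 := fun h' => htip (h' ▸ hk3)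
        rcases rb_fin4_cases k (e i).2 hd2 hd3 with hdk | hdk
        · have hei : e i = ((e j).1, k) := Prod.ext h hdk
          rcases hcases with ⟨hej, -⟩ | ⟨-, hejm⟩
          · have := hnodup i j hi hjP (hei.trans hej.symm); omega
          · rw [show j + P - 1 = (j - 1) + P by omega, hper] at hejm
            have := hnodup i (j - 1) hi (by omega) (hei.trans hejm.symm); omega
        · have hei : e i = ((e j).1, k + 1) := Prod.ext h hdk
          rcases hcases with ⟨-, hej1⟩ | ⟨hej, -⟩
          · by_cases hjP' : j + 1 = P
            · rw [hjP', ← zero_add P, hper] at hej1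
              have := hnodup i 0 hi hP (hei.trans hej1.symm); omega
            · have := hnodup i (j + 1) hi (by omega) (hei.trans hej1.symm); omega
          · have := hnodup i j hi hjP (hei.trans hej.symm); omega

end Summit.CriticalPhenomena.CardyFormulaZ2.Cruxes.RectilinearCardy.ExcursionKernelCovariance

end
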